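import Literature.Analysis.FluidPDE.L3WeakCompactness
import Literature.Analysis.FluidPDE.ForwardDSSExistence
import Literature.Analysis.FluidPDE.LocalLerayExistence
import Literature.Analysis.FunctionSpaces.WeakLpQuantitative
import HarnessLib

/-!
# Weak compactness of weak-`L³`-bounded sequences of fields on `ℝ³` (datum extraction for
# blow-down sequences with `L^{3,∞}` control)

Analysis/FluidPDE proof file (theorems only: no definition, no named fact, no `sorry`) on the
discharge path of the named fact
`Literature.Analysis.FluidPDE.AlbrittonBarker2019_liouville_weakL3_backward`
(`AncientL3BackwardLiouville.lean`; Albritton–Barker, J. Math. Fluid Mech. 21 (2019) no. 43 =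
arXiv:1811.00502, **Thm. 4.1**). In the proof of Thm. 4.1 (arXiv p. 9) the blow-down data
`v^{(k)}(·,−1)` are bounded in `L^{3,∞}` only ("`‖v^{(k)}(·,−1)‖_{L^{3,∞}} ≤ M`") and the
compactness step extracts "`v^{(k)}(·,−1) ⇀* u(·,−1)` in `L^{3,∞}`" (Barker–Seregin–Šverák 2018,
proof of Thm. 1.3, §3.2: "`u₀^{(k)} ⇀* u₀` in `L^{3,∞}` and … `M := sup_k ‖u₀^{(k)}‖_{L^{3,∞}} < ∞`").
The tree's limiting procedures consume the datum through pairings with test fields and through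
the class `E²` (`MemE2`: `L²_uloc` with unit-ball energies vanishing at infinity, the datum class
of Seregin's decay theorem `seregin2014_limit_decay`). This file proves the corresponding
extraction **without** a predual of `L^{3,∞}`: every weak-`L³` field splits at height `1` as
`a = g + h`, `‖g‖₂² ≤ 3M`, `‖h‖₄⁴ ≤ 4M`, `|h| ≤ 1` (`WeakLpQuantitative.lean`), and bounded
sequences in `L²(dx)` and in `L⁴ ∩ L^∞(dx)` are weakly sequentially compact inside the separable
Hilbert space `L²((1+|x|)⁻⁴dx)` of `L3WeakCompactness.lean` (Brezis 2011, Thm. 3.18, with the weak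
closedness of closed convex sets, Thm. 3.7):

* `MemE2.add` — `E²` is closed under sums;
* `convex_setOf_eLpNorm_le`, `isClosed_setOf_eLpNorm_le` — the `L^q(dx)`-balls are closed convex
  subsets of `L²(w dx)` (Minkowski; Fatou under a.e. convergence of a subsequence);
* `exists_strictMono_weakLimit_of_mem_convex_isClosed` — extraction inside a closed convex set,
  with convergence of the pairings against continuous compactly supported fields;
* `exists_strictMono_weakLimit_weakL3` — from `a_k` with `sup_t t³|{|a_k| > t}| ≤ M`: a subsequence
  and a limit `g + h`, `g ∈ L²` (`‖g‖₂ ≤ (3M)^{1/2}`), `h ∈ L⁴ ∩ L^∞` (`‖h‖₄ ≤ (4M)^{1/4}`,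
  `‖h‖_∞ ≤ 1`), with `∫⟪a_{σ(k)}, φ⟫ → ∫⟪g + h, φ⟫` for continuous compactly supported `φ`;
  the limit lies in `E²` (`memE2_add_of_memLp`).

## Mathlib / tree search

Tree (reused): `l3μ`, `l3Weight`, `mem_of_tendsto_inner_of_convex_isClosed`,
`memLp_weightInv_smul`, `inner_toLp_weightInv_smul`, `aestronglyMeasurable_volume_of_Lp`,
`isFiniteMeasure_l3μ`, `volume_absolutelyContinuous_l3μ` (`L3WeakCompactness.lean`, the `L³`
version `exists_strictMono_tendsto_integral_inner_of_eLpNorm_three_le` being the model);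
`FunctionSpaces.exists_strictMono_tendsto_inner_of_norm_le`; `MemE2`, `memE2_of_memLp`
(`LocalLerayExistence.lean`); `setLIntegral_enorm_sq_le_two_mul` (`ForwardDSSExistence.lean`);
the quantitative splits `MemWeakLp.lintegral_rpow_indicator_lt_norm_le`,
`MemWeakLp.lintegral_rpow_indicator_norm_le_le` (`WeakLpQuantitative.lean`). Mathlib:
`Lp.eLpNorm_lim_le_liminf_eLpNorm`, `tendstoInMeasure_of_tendsto_Lp`, `eLpNorm_le_of_ae_bound`,
`MemLp.of_bound`, `ae_le_eLpNormEssSup`.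

## References

* D. Albritton, T. Barker, arXiv:1811.00502, §4, proof of Thm. 4.1 (p. 9). [`AlbrittonBarker2019`]
* T. Barker, G. Seregin, V. Šverák, Comm. PDE 43 (2018) = arXiv:1603.03211, §3.2 (proof of
  Thm. 1.3), Lemma 2.1. [`BarkerSeregin2016`]
* H. Brezis, *Functional Analysis, Sobolev Spaces and PDE* (2011), Thm. 3.7, Thm. 3.18.
-/

noncomputable section

open MeasureTheory TopologicalSpace Set Function Filter Metric
open _root_.Topology
open scoped ENNReal NNReal RealInnerProductSpace

namespace Literature.Analysis.FluidPDE

local notation "ℝ³" => EuclideanSpace ℝ (Fin 3)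

/-! ### `E²` is closed under sums -/

/-- **`E²` is a vector space**: sums of `E²` fields are `E²` fields
(`∫_B |u + v|² ≤ 2∫_B |u|² + 2∫_B |v|²`). [folklore] -/
theorem MemE2.add {u v : ℝ³ → ℝ³} (hu : MemE2 u) (hv : MemE2 v) : MemE2 (u + v) := by
  have hm : AEStronglyMeasurable (u + v) volume := hu.aestronglyMeasurable.add hv.aestronglyMeasurable
  have hball : ∀ x₀ : ℝ³, ∫⁻ x in ball x₀ 1, ‖(u + v) x‖ₑ ^ 2 ≤
      2 * (∫⁻ x in ball x₀ 1, ‖u x‖ₑ ^ 2) + 2 * ∫⁻ x in ball x₀ 1, ‖v x‖ₑ ^ 2 := by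
    intro x₀
    have h := BradshawTsai2019.setLIntegral_enorm_sq_le_two_mul (ball x₀ 1) hm hv.aestronglyMeasurable
    simpa only [Pi.add_apply, add_sub_cancel_right] using h
  obtain ⟨C₁, hC₁⟩ := hu.uniformlyLocal
  obtain ⟨C₂, hC₂⟩ := hv.uniformlyLocal
  refine ⟨hm, ⟨2 * C₁ + 2 * C₂, fun x₀ => (hball x₀).trans ?_⟩, ?_⟩
  · push_cast
    exact add_le_add (mul_le_mul' le_rfl (hC₁ x₀)) (mul_le_mul' le_rfl (hC₂ x₀))
  · have h0 : Tendsto (fun x₀ : ℝ³ => 2 * (∫⁻ x in ball x₀ 1, ‖u x‖ₑ ^ 2) +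
        2 * ∫⁻ x in ball x₀ 1, ‖v x‖ₑ ^ 2) (cocompact ℝ³) (𝓝 0) := by
      have h1 : Tendsto (fun x₀ : ℝ³ => (2 : ℝ≥0∞) * ∫⁻ x in ball x₀ 1, ‖u x‖ₑ ^ 2) (cocompact ℝ³)
          (𝓝 ((2 : ℝ≥0∞) * 0)) :=
        ENNReal.Tendsto.const_mul hu.decay (Or.inr ENNReal.ofNat_ne_top)
      have h2 : Tendsto (fun x₀ : ℝ³ => (2 : ℝ≥0∞) * ∫⁻ x in ball x₀ 1, ‖v x‖ₑ ^ 2) (cocompact ℝ³)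
          (𝓝 ((2 : ℝ≥0∞) * 0)) :=
        ENNReal.Tendsto.const_mul hv.decay (Or.inr ENNReal.ofNat_ne_top)
      rw [mul_zero] at h1 h2
      simpa using h1.add h2
    exact tendsto_of_tendsto_of_tendsto_of_le_of_le tendsto_const_nhds h0 (fun _ => zero_le)
      hball

/-- **`L² + L⁴ ⊂ E²`** (sums of Lebesgue fields with exponents in `[2, ∞)`). [folklore] -/
theorem memE2_add_of_memLp {g h : ℝ³ → ℝ³} {p q : ℝ≥0∞} (hg : MemLp g p volume) (h2p : 2 ≤ p)
    (hp : p ≠ ∞) (hh : MemLp h q volume) (h2q : 2 ≤ q) (hq : q ≠ ∞) : MemE2 (g + h) :=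
  (memE2_of_memLp hg h2p hp).add (memE2_of_memLp hh h2q hq)

/-! ### Closed convex Lebesgue balls inside `L²(w dx)` -/

/-- The `L^q(dx)`-ball `{f : ‖f‖_{L^q(dx)} ≤ R}` is a convex subset of `L²(w dx)`, `1 ≤ q`
(Minkowski). [folklore] -/
theorem convex_setOf_eLpNorm_le {q : ℝ≥0∞} (hq : 1 ≤ q) (R : ℝ≥0∞) :
    Convex ℝ {f : Lp ℝ³ 2 l3μ | eLpNorm (f : ℝ³ → ℝ³) q volume ≤ R} := by
  intro f hf g hg s t hs ht hst
  rw [mem_setOf_eq] at hf hg ⊢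
  have hae : ((s • f + t • g : Lp ℝ³ 2 l3μ) : ℝ³ → ℝ³) =ᵐ[volume]
      s • (f : ℝ³ → ℝ³) + t • (g : ℝ³ → ℝ³) :=
    volume_absolutelyContinuous_l3μ.ae_eq
      ((Lp.coeFn_add (s • f) (t • g)).trans ((Lp.coeFn_smul s f).add (Lp.coeFn_smul t g)))
  rw [eLpNorm_congr_ae hae]
  have hfm := aestronglyMeasurable_volume_of_Lp f
  have hgm := aestronglyMeasurable_volume_of_Lp g
  calc eLpNorm (s • (f : ℝ³ → ℝ³) + t • (g : ℝ³ → ℝ³)) q volume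
      ≤ eLpNorm (s • (f : ℝ³ → ℝ³)) q volume + eLpNorm (t • (g : ℝ³ → ℝ³)) q volume :=
        eLpNorm_add_le (hfm.const_smul s) (hgm.const_smul t) hq
    _ = ENNReal.ofReal s * eLpNorm (f : ℝ³ → ℝ³) q volume +
          ENNReal.ofReal t * eLpNorm (g : ℝ³ → ℝ³) q volume := by
        rw [eLpNorm_const_smul, eLpNorm_const_smul, Real.enorm_eq_ofReal hs,
          Real.enorm_eq_ofReal ht]
    _ ≤ ENNReal.ofReal s * R + ENNReal.ofReal t * R :=
        add_le_add (mul_le_mul' le_rfl hf) (mul_le_mul' le_rfl hg)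
    _ = R := by
        rw [← add_mul, ← ENNReal.ofReal_add hs ht, hst, ENNReal.ofReal_one, one_mul]

/-- The `L^q(dx)`-ball is closed in `L²(w dx)` (convergence in `L²(w dx)` gives a.e. convergence of
a subsequence, `w dx ∼ dx`, and the `L^q` seminorm is lower semicontinuous under a.e. convergence,
Fatou). [folklore] -/
theorem isClosed_setOf_eLpNorm_le (q : ℝ≥0∞) (R : ℝ≥0∞) :
    IsClosed {f : Lp ℝ³ 2 l3μ | eLpNorm (f : ℝ³ → ℝ³) q volume ≤ R} := by
  refine isSeqClosed_iff_isClosed.1 fun f b hf hfb => ?_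
  rw [mem_setOf_eq]
  have hmeas : TendstoInMeasure l3μ (fun n => (f n : ℝ³ → ℝ³)) atTop (b : ℝ³ → ℝ³) :=
    tendstoInMeasure_of_tendsto_Lp hfb
  obtain ⟨ns, -, hae⟩ := hmeas.exists_seq_tendsto_ae
  have haev : ∀ᵐ x ∂(volume : Measure ℝ³),
      Tendsto (fun i => (f (ns i) : ℝ³ → ℝ³) x) atTop (𝓝 ((b : ℝ³ → ℝ³) x)) :=
    volume_absolutelyContinuous_l3μ.ae_le hae
  refine (Lp.eLpNorm_lim_le_liminf_eLpNorm
    (fun i => aestronglyMeasurable_volume_of_Lp (f (ns i))) _ haev).trans ?_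
  exact Filter.liminf_le_of_frequently_le' (Frequently.of_forall fun i => (hf (ns i)))

/-! ### Embeddings into `L²(w dx)` -/

/-- **`L²(dx) ↪ L²(w dx)`** with constant `1` (the weight is at most `1`). [folklore] -/
theorem eLpNorm_two_l3μ_le_eLpNorm_two (f : ℝ³ → ℝ³) : eLpNorm f 2 l3μ ≤ eLpNorm f 2 volume := by
  rw [eLpNorm_eq_lintegral_rpow_enorm_toReal two_ne_zero ENNReal.ofNat_ne_top,
    eLpNorm_eq_lintegral_rpow_enorm_toReal two_ne_zero ENNReal.ofNat_ne_top, lintegral_l3μ_eq]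
  refine ENNReal.rpow_le_rpow (lintegral_mono fun x => ?_) (by positivity)
  calc (l3Weight x : ℝ≥0∞) * ‖f x‖ₑ ^ (2 : ℝ≥0∞).toReal ≤ 1 * ‖f x‖ₑ ^ (2 : ℝ≥0∞).toReal :=
        mul_le_mul' (ENNReal.coe_le_one_iff.2 (l3Weight_le_one x)) le_rfl
    _ = ‖f x‖ₑ ^ (2 : ℝ≥0∞).toReal := one_mul _

/-- An `L²(dx)` field lies in `L²(w dx)`. [folklore] -/
theorem memLp_two_l3μ_of_memLp_two {f : ℝ³ → ℝ³} (hf : MemLp f 2 volume) : MemLp f 2 l3μ :=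
  ⟨hf.1.mono_ac l3μ_absolutelyContinuous_volume,
    lt_of_le_of_lt (eLpNorm_two_l3μ_le_eLpNorm_two f) hf.eLpNorm_lt_top⟩

/-- A measurable field bounded by `1` lies in `L²(w dx)` (a finite measure), with
`‖f‖_{L²(w dx)} ≤ (w dx)(ℝ³)^{1/2}`. [folklore] -/
theorem memLp_two_l3μ_of_norm_le_one {f : ℝ³ → ℝ³} (hf : AEStronglyMeasurable f volume)
    (h1 : ∀ᵐ x ∂(volume : Measure ℝ³), ‖f x‖ ≤ 1) :
    MemLp f 2 l3μ ∧ eLpNorm f 2 l3μ ≤ l3μ univ ^ (1 / 2 : ℝ) := by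
  haveI : IsFiniteMeasure l3μ := isFiniteMeasure_l3μ
  have h1' : ∀ᵐ x ∂l3μ, ‖f x‖ ≤ 1 := l3μ_absolutelyContinuous_volume.ae_le h1
  have hm : AEStronglyMeasurable f l3μ := hf.mono_ac l3μ_absolutelyContinuous_volume
  refine ⟨MemLp.of_bound hm 1 h1', (eLpNorm_le_of_ae_bound h1').trans (le_of_eq ?_)⟩
  rw [ENNReal.ofReal_one, mul_one, ENNReal.toReal_ofNat, one_div]

/-! ### Extraction inside a closed convex set -/

/-- **Weak sequential compactness inside a closed convex subset of `L²(w dx)`**: a norm-bounded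
sequence in a closed convex `S ⊆ L²(w dx)` has a subsequence whose pairings with continuous
compactly supported fields converge to those of some `b ∈ S` (Brezis 2011, Thm. 3.18 with
Thm. 3.7: `exists_strictMono_tendsto_inner_of_norm_le`, `mem_of_tendsto_inner_of_convex_isClosed`,
and `⟪g, φ/w⟫_{L²(w dx)} = ∫⟪g, φ⟫ dx`). [cite: Brezis2011, Thm. 3.18 with Thm. 3.7] -/
theorem exists_strictMono_weakLimit_of_mem_convex_isClosed {S : Set (Lp ℝ³ 2 l3μ)}
    (hS : Convex ℝ S) (hSc : IsClosed S) {F : ℕ → Lp ℝ³ 2 l3μ} (hF : ∀ n, F n ∈ S) {R : ℝ}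
    (hR : ∀ n, ‖F n‖ ≤ R) :
    ∃ (σ : ℕ → ℕ) (b : Lp ℝ³ 2 l3μ), StrictMono σ ∧ b ∈ S ∧
      ∀ φ : ℝ³ → ℝ³, Continuous φ → HasCompactSupport φ →
        Tendsto (fun k => ∫ x, ⟪(F (σ k) : ℝ³ → ℝ³) x, φ x⟫) atTop
          (𝓝 (∫ x, ⟪(b : ℝ³ → ℝ³) x, φ x⟫)) := by
  haveI : Fact ((2 : ℝ≥0∞) ≠ ⊤) := ⟨ENNReal.ofNat_ne_top⟩
  haveI : SFinite l3μ := by unfold l3μ; infer_instance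
  obtain ⟨σ, hσ, b, -, hw⟩ :=
    FunctionSpaces.exists_strictMono_tendsto_inner_of_norm_le (H := Lp ℝ³ 2 l3μ) hR
  have hbS : b ∈ S :=
    mem_of_tendsto_inner_of_convex_isClosed hS hSc (v := fun n => F (σ n)) (fun n => hF (σ n)) hw
  refine ⟨σ, b, hσ, hbS, fun φ hφ hφc => ?_⟩
  have h := hw ((memLp_weightInv_smul hφ hφc).toLp _)
  rw [inner_toLp_weightInv_smul b hφ hφc] at h
  refine h.congr fun k => ?_
  rw [inner_toLp_weightInv_smul (F (σ k)) hφ hφc]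

/-! ### Pairings of the pieces -/

/-- Pairings of an `L²` field with a continuous compactly supported field are integrable. [folklore] -/
theorem integrable_inner_of_memLp_two_of_continuous {g φ : ℝ³ → ℝ³} (hg : MemLp g 2 volume)
    (hφ : Continuous φ) (hφc : HasCompactSupport φ) : Integrable (fun x => ⟪g x, φ x⟫) volume := by
  have hφ2 : MemLp φ 2 volume := hφ.memLp_of_hasCompactSupport hφc
  have h : MemLp ((fun x => ‖φ x‖) * fun x => ‖g x‖) 1 volume := hg.norm.mul hφ2.norm
  refine (memLp_one_iff_integrable.1 h).mono' (hg.1.inner hφ2.1) (Eventually.of_forall fun x => ?_)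
  rw [Pi.mul_apply, Real.norm_eq_abs, mul_comm]
  exact abs_real_inner_le_norm _ _

/-- Pairings of an a.e.-bounded measurable field with a continuous compactly supported field are
integrable. [folklore] -/
theorem integrable_inner_of_ae_norm_le_of_continuous {h φ : ℝ³ → ℝ³}
    (hh : AEStronglyMeasurable h volume) {C : ℝ} (hC : ∀ᵐ x ∂(volume : Measure ℝ³), ‖h x‖ ≤ C)
    (hφ : Continuous φ) (hφc : HasCompactSupport φ) : Integrable (fun x => ⟪h x, φ x⟫) volume := by
  have hφi : Integrable φ volume := hφ.integrable_of_hasCompactSupport hφc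
  refine (hφi.norm.const_mul (max C 0)).mono' (hh.inner hφ.aestronglyMeasurable) ?_
  filter_upwards [hC] with x hx
  rw [Real.norm_eq_abs]
  calc |⟪h x, φ x⟫| ≤ ‖h x‖ * ‖φ x‖ := abs_real_inner_le_norm _ _
    _ ≤ max C 0 * ‖φ x‖ := mul_le_mul_of_nonneg_right (hx.trans (le_max_left _ _)) (norm_nonneg _)

/-- An `L^∞` bound gives an a.e. pointwise bound. [folklore] -/
theorem ae_norm_le_one_of_eLpNorm_top_le_one {h : ℝ³ → ℝ³} (hh : eLpNorm h ∞ volume ≤ 1) :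
    ∀ᵐ x ∂(volume : Measure ℝ³), ‖h x‖ ≤ 1 := by
  rw [eLpNorm_exponent_top] at hh
  filter_upwards [ae_le_eLpNormEssSup (μ := (volume : Measure ℝ³)) (f := h)] with x hx
  have h1 : ‖h x‖ₑ ≤ 1 := hx.trans hh
  rwa [← ofReal_norm, ENNReal.ofReal_le_one] at h1

/-! ### The extraction for weak-`L³`-bounded data -/

/-- `‖g‖_{L²} ≤ (3M)^{1/2}` from `∫‖g‖² ≤ 3M`, and `‖h‖_{L⁴} ≤ (4M)^{1/4}` from `∫‖h‖⁴ ≤ 4M`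
(unfolding `eLpNorm`). [folklore] -/
theorem eLpNorm_le_rpow_of_lintegral_rpow_le {f : ℝ³ → ℝ³} {q : ℝ≥0∞} (hq0 : q ≠ 0) (hq : q ≠ ∞)
    {B : ℝ≥0∞} (h : ∫⁻ x, ‖f x‖ₑ ^ q.toReal ≤ B) :
    eLpNorm f q volume ≤ B ^ (1 / q.toReal) := by
  rw [eLpNorm_eq_lintegral_rpow_enorm_toReal hq0 hq]
  exact ENNReal.rpow_le_rpow h (by positivity)

set_option maxHeartbeats 1600000 in
/-- **Weak compactness of weak-`L³`-bounded sequences of fields** (the datum extraction for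
blow-down sequences with `L^{3,∞}` control; Barker–Seregin–Šverák 2018, proof of Thm. 1.3, §3.2,
"`u₀^{(k)} ⇀* u₀`", realised through the height-one splitting of Lemma 2.1 and Hilbert-space weak
compactness): if `a_k` are weak-`L³` fields on `ℝ³` with `sup_t t³ |{|a_k| > t}| ≤ M`, then along
a subsequence `σ` the pairings `∫⟪a_{σ(k)}, φ⟫` with continuous compactly supported fields
converge to `∫⟪g + h, φ⟫` for some `g ∈ L²` with `‖g‖₂ ≤ (3M)^{1/2}` and some `h ∈ L⁴ ∩ L^∞` with
`‖h‖₄ ≤ (4M)^{1/4}`, `‖h‖_∞ ≤ 1`. [cite: BarkerSeregin2016, proof of Thm. 1.3 §3.2 with Lemma 2.1 (arXiv:1603.03211 pp. 5, 9)] -/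
theorem exists_strictMono_weakLimit_weakL3 (M : ℝ≥0) (a : ℕ → ℝ³ → ℝ³)
    (ha : ∀ k, FunctionSpaces.MemWeakLp (a k) 3 volume)
    (hM : ∀ k, FunctionSpaces.eWeakLpPow (a k) 3 volume ≤ M) :
    ∃ (σ : ℕ → ℕ) (g h : ℝ³ → ℝ³), StrictMono σ ∧
      MemLp g 2 volume ∧ eLpNorm g 2 volume ≤ (3 * (M : ℝ≥0∞)) ^ (1 / 2 : ℝ) ∧
      MemLp h 4 volume ∧ eLpNorm h 4 volume ≤ (4 * (M : ℝ≥0∞)) ^ (1 / 4 : ℝ) ∧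
      eLpNorm h ∞ volume ≤ 1 ∧
      ∀ φ : ℝ³ → ℝ³, Continuous φ → HasCompactSupport φ →
        Tendsto (fun k => ∫ x, ⟪a (σ k) x, φ x⟫) atTop (𝓝 (∫ x, ⟪g x + h x, φ x⟫)) := by
  haveI : Fact ((2 : ℝ≥0∞) ≠ ⊤) := ⟨ENNReal.ofNat_ne_top⟩
  haveI : IsFiniteMeasure l3μ := isFiniteMeasure_l3μ
  -- ### Step 0: representatives and the height-one splitting
  set f : ℕ → ℝ³ → ℝ³ := fun k => (ha k).1.mk (a k) with hf
  have hfm : ∀ k, StronglyMeasurable (f k) := fun k => (ha k).1.stronglyMeasurable_mk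
  have haf : ∀ k, a k =ᵐ[volume] f k := fun k => (ha k).1.ae_eq_mk
  have hWf : ∀ k, FunctionSpaces.eWeakLpPow (f k) 3 volume ≤ M := fun k => by
    rw [← FunctionSpaces.eWeakLpPow_congr_ae (haf k)]; exact hM k
  set g : ℕ → ℝ³ → ℝ³ := fun k => {x | 1 < ‖f k x‖}.indicator (f k) with hg
  set h : ℕ → ℝ³ → ℝ³ := fun k => {x | ‖f k x‖ ≤ 1}.indicator (f k) with hh
  have hA : ∀ k, MeasurableSet {x | 1 < ‖f k x‖} := fun k =>
    measurableSet_lt measurable_const (hfm k).norm.measurable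
  have hB : ∀ k, MeasurableSet {x | ‖f k x‖ ≤ 1} := fun k =>
    measurableSet_le (hfm k).norm.measurable measurable_const
  have hgm : ∀ k, AEStronglyMeasurable (g k) volume := fun k =>
    (hfm k).aestronglyMeasurable.indicator (hA k)
  have hhm : ∀ k, AEStronglyMeasurable (h k) volume := fun k =>
    (hfm k).aestronglyMeasurable.indicator (hB k)
  have hsplit : ∀ k, g k + h k = f k := fun k =>
    FunctionSpaces.indicator_lt_norm_add_indicator_norm_le (f k) 1
  have hh1 : ∀ k x, ‖h k x‖ ≤ 1 := fun k x => FunctionSpaces.norm_indicator_norm_le_le (f k) zero_le_one x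
  -- the sizes of the pieces
  set B₂ : ℝ≥0∞ := 3 * (M : ℝ≥0∞) with hB₂
  set B₄ : ℝ≥0∞ := 4 * (M : ℝ≥0∞) with hB₄
  have hB₂top : B₂ ≠ ∞ := ENNReal.mul_ne_top ENNReal.ofNat_ne_top ENNReal.coe_ne_top
  have hB₄top : B₄ ≠ ∞ := ENNReal.mul_ne_top ENNReal.ofNat_ne_top ENNReal.coe_ne_top
  have hg2int : ∀ k, ∫⁻ x, ‖g k x‖ₑ ^ (2 : ℝ≥0∞).toReal ≤ B₂ := by
    intro k
    have h1 := FunctionSpaces.MemWeakLp.lintegral_rpow_indicator_lt_norm_le (p := 3) (μ := volume)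
      (hfm k).aestronglyMeasurable (hA k) (r := 2) zero_lt_two
      (by rw [ENNReal.toReal_ofNat]; norm_num) zero_lt_one
    rw [ENNReal.toReal_ofNat]
    refine h1.trans ?_
    rw [ENNReal.toReal_ofNat, Real.one_rpow, mul_one, show ((3 : ℝ) / (3 - 2)) = 3 by norm_num,
      ENNReal.ofReal_ofNat]
    exact mul_le_mul' le_rfl (hWf k)
  have hh4int : ∀ k, ∫⁻ x, ‖h k x‖ₑ ^ (4 : ℝ≥0∞).toReal ≤ B₄ := by
    intro k
    have h1 := FunctionSpaces.MemWeakLp.lintegral_rpow_indicator_norm_le_le (p := 3) (μ := volume)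
      (hfm k).aestronglyMeasurable (hB k) (q := 4) (by rw [ENNReal.toReal_ofNat]; norm_num)
      zero_lt_one
    rw [ENNReal.toReal_ofNat]
    refine h1.trans ?_
    rw [ENNReal.toReal_ofNat, Real.one_rpow, mul_one, show ((4 : ℝ) / (4 - 3)) = 4 by norm_num,
      ENNReal.ofReal_ofNat]
    exact mul_le_mul' le_rfl (hWf k)
  have hg2 : ∀ k, MemLp (g k) 2 volume ∧ eLpNorm (g k) 2 volume ≤ B₂ ^ (1 / 2 : ℝ) := by
    intro k
    have hle : eLpNorm (g k) 2 volume ≤ B₂ ^ (1 / (2 : ℝ≥0∞).toReal) :=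
      eLpNorm_le_rpow_of_lintegral_rpow_le two_ne_zero ENNReal.ofNat_ne_top (hg2int k)
    rw [ENNReal.toReal_ofNat] at hle
    exact ⟨⟨hgm k, hle.trans_lt (ENNReal.rpow_lt_top_of_nonneg (by norm_num) hB₂top)⟩, hle⟩
  have hh4 : ∀ k, MemLp (h k) 4 volume ∧ eLpNorm (h k) 4 volume ≤ B₄ ^ (1 / 4 : ℝ) := by
    intro k
    have hle : eLpNorm (h k) 4 volume ≤ B₄ ^ (1 / (4 : ℝ≥0∞).toReal) :=
      eLpNorm_le_rpow_of_lintegral_rpow_le (by norm_num) ENNReal.ofNat_ne_top (hh4int k)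
    rw [ENNReal.toReal_ofNat] at hle
    exact ⟨⟨hhm k, hle.trans_lt (ENNReal.rpow_lt_top_of_nonneg (by norm_num) hB₄top)⟩, hle⟩
  have hhtop : ∀ k, eLpNorm (h k) ∞ volume ≤ 1 := fun k => by
    rw [eLpNorm_exponent_top]
    refine (eLpNormEssSup_le_of_ae_bound (C := 1) (Eventually.of_forall (hh1 k))).trans ?_
    rw [ENNReal.ofReal_one]
  -- ### Step 1: the `L²` pieces in `H = L²(w dx)`
  set S₂ : Set (Lp ℝ³ 2 l3μ) := {F | eLpNorm (F : ℝ³ → ℝ³) 2 volume ≤ B₂ ^ (1 / 2 : ℝ)} with hS₂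
  set G : ℕ → Lp ℝ³ 2 l3μ := fun k => (memLp_two_l3μ_of_memLp_two (hg2 k).1).toLp (g k) with hG
  have hGae : ∀ k, ((G k : Lp ℝ³ 2 l3μ) : ℝ³ → ℝ³) =ᵐ[volume] g k := fun k =>
    volume_absolutelyContinuous_l3μ.ae_eq (MemLp.coeFn_toLp _)
  have hGS : ∀ k, G k ∈ S₂ := fun k => by
    rw [hS₂, mem_setOf_eq, eLpNorm_congr_ae (hGae k)]
    exact (hg2 k).2
  set R₂ : ℝ := (B₂ ^ (1 / 2 : ℝ)).toReal with hR₂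
  have hGR : ∀ k, ‖G k‖ ≤ R₂ := fun k => by
    rw [hG, Lp.norm_toLp, hR₂]
    exact ENNReal.toReal_mono (ENNReal.rpow_ne_top_of_nonneg (by norm_num) hB₂top)
      ((eLpNorm_two_l3μ_le_eLpNorm_two _).trans (hg2 k).2)
  obtain ⟨σ₁, bG, hσ₁, hbGS, hconvG⟩ := exists_strictMono_weakLimit_of_mem_convex_isClosed
    (convex_setOf_eLpNorm_le (q := 2) (by norm_num) _) (isClosed_setOf_eLpNorm_le 2 _) hGS hGR
  -- ### Step 2: the bounded `L⁴` pieces along `σ₁`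
  set S₄ : Set (Lp ℝ³ 2 l3μ) := {F | eLpNorm (F : ℝ³ → ℝ³) 4 volume ≤ B₄ ^ (1 / 4 : ℝ)} ∩
    {F | eLpNorm (F : ℝ³ → ℝ³) ∞ volume ≤ 1} with hS₄
  have hS₄c : Convex ℝ S₄ :=
    (convex_setOf_eLpNorm_le (q := 4) (by norm_num) _).inter (convex_setOf_eLpNorm_le le_top _)
  have hS₄cl : IsClosed S₄ := (isClosed_setOf_eLpNorm_le 4 _).inter (isClosed_setOf_eLpNorm_le ∞ _)
  have hHmem : ∀ k, MemLp (h k) 2 l3μ ∧ eLpNorm (h k) 2 l3μ ≤ l3μ univ ^ (1 / 2 : ℝ) := fun k =>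
    memLp_two_l3μ_of_norm_le_one (hhm k) (Eventually.of_forall (hh1 k))
  set Hk : ℕ → Lp ℝ³ 2 l3μ := fun k => (hHmem (σ₁ k)).1.toLp (h (σ₁ k)) with hHk
  have hHae : ∀ k, ((Hk k : Lp ℝ³ 2 l3μ) : ℝ³ → ℝ³) =ᵐ[volume] h (σ₁ k) := fun k =>
    volume_absolutelyContinuous_l3μ.ae_eq (MemLp.coeFn_toLp _)
  have hHS : ∀ k, Hk k ∈ S₄ := fun k => by
    refine ⟨?_, ?_⟩
    · rw [mem_setOf_eq, eLpNorm_congr_ae (hHae k)]; exact (hh4 (σ₁ k)).2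
    · rw [mem_setOf_eq, eLpNorm_congr_ae (hHae k)]; exact hhtop (σ₁ k)
  set R₄ : ℝ := (l3μ univ ^ (1 / 2 : ℝ)).toReal with hR₄
  have hHR : ∀ k, ‖Hk k‖ ≤ R₄ := fun k => by
    rw [hHk, Lp.norm_toLp, hR₄]
    exact ENNReal.toReal_mono
      (ENNReal.rpow_ne_top_of_nonneg (by norm_num) (measure_ne_top l3μ univ)) (hHmem (σ₁ k)).2
  obtain ⟨σ₂, bH, hσ₂, hbHS, hconvH⟩ :=
    exists_strictMono_weakLimit_of_mem_convex_isClosed hS₄c hS₄cl hHS hHR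
  -- ### Step 3: the limit `bG + bH` along `σ = σ₁ ∘ σ₂`
  have hbGm : AEStronglyMeasurable (bG : ℝ³ → ℝ³) volume := aestronglyMeasurable_volume_of_Lp bG
  have hbHm : AEStronglyMeasurable (bH : ℝ³ → ℝ³) volume := aestronglyMeasurable_volume_of_Lp bH
  have hbG2 : MemLp (bG : ℝ³ → ℝ³) 2 volume :=
    ⟨hbGm, lt_of_le_of_lt hbGS (ENNReal.rpow_lt_top_of_nonneg (by norm_num) hB₂top)⟩
  have hbH4 : MemLp (bH : ℝ³ → ℝ³) 4 volume :=
    ⟨hbHm, lt_of_le_of_lt hbHS.1 (ENNReal.rpow_lt_top_of_nonneg (by norm_num) hB₄top)⟩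
  have hbH1 : ∀ᵐ x ∂(volume : Measure ℝ³), ‖(bH : ℝ³ → ℝ³) x‖ ≤ 1 :=
    ae_norm_le_one_of_eLpNorm_top_le_one hbHS.2
  refine ⟨σ₁ ∘ σ₂, (bG : ℝ³ → ℝ³), (bH : ℝ³ → ℝ³), hσ₁.comp hσ₂, hbG2, hbGS, hbH4, hbHS.1, hbHS.2,
    fun φ hφ hφc => ?_⟩
  -- the pairings split
  have hpa : ∀ k, ∫ x, ⟪a k x, φ x⟫ = (∫ x, ⟪g k x, φ x⟫) + ∫ x, ⟪h k x, φ x⟫ := by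
    intro k
    rw [← integral_add (integrable_inner_of_memLp_two_of_continuous (hg2 k).1 hφ hφc)
      (integrable_inner_of_ae_norm_le_of_continuous (hhm k) (Eventually.of_forall (hh1 k)) hφ hφc)]
    refine integral_congr_ae ?_
    filter_upwards [haf k] with x hx
    rw [hx, ← inner_add_left, ← Pi.add_apply, hsplit k]
  have hpL : ∫ x, ⟪(bG : ℝ³ → ℝ³) x + (bH : ℝ³ → ℝ³) x, φ x⟫ =
      (∫ x, ⟪(bG : ℝ³ → ℝ³) x, φ x⟫) + ∫ x, ⟪(bH : ℝ³ → ℝ³) x, φ x⟫ := by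
    rw [← integral_add (integrable_inner_of_memLp_two_of_continuous hbG2 hφ hφc)
      (integrable_inner_of_ae_norm_le_of_continuous hbHm hbH1 hφ hφc)]
    exact integral_congr_ae (Eventually.of_forall fun x => inner_add_left _ _ _)
  -- the `g`-pairings along `σ₁ ∘ σ₂`
  have hcg : Tendsto (fun k => ∫ x, ⟪g (σ₁ (σ₂ k)) x, φ x⟫) atTop (𝓝 (∫ x, ⟪(bG : ℝ³ → ℝ³) x, φ x⟫)) := by
    have h1 : Tendsto (fun k => ∫ x, ⟪g (σ₁ k) x, φ x⟫) atTop (𝓝 (∫ x, ⟪(bG : ℝ³ → ℝ³) x, φ x⟫)) := by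
      refine (hconvG φ hφ hφc).congr fun k => integral_congr_ae ?_
      filter_upwards [hGae (σ₁ k)] with x hx
      rw [hx]
    exact h1.comp hσ₂.tendsto_atTop
  -- the `h`-pairings along `σ₂`
  have hch : Tendsto (fun k => ∫ x, ⟪h (σ₁ (σ₂ k)) x, φ x⟫) atTop (𝓝 (∫ x, ⟪(bH : ℝ³ → ℝ³) x, φ x⟫)) := by
    refine (hconvH φ hφ hφc).congr fun k => integral_congr_ae ?_
    filter_upwards [hHae (σ₂ k)] with x hx
    rw [hx]
  have e : (fun k => ∫ x, ⟪a ((σ₁ ∘ σ₂) k) x, φ x⟫) =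
      fun k => (∫ x, ⟪g (σ₁ (σ₂ k)) x, φ x⟫) + ∫ x, ⟪h (σ₁ (σ₂ k)) x, φ x⟫ :=
    funext fun k => hpa _
  rw [e, hpL]
  exact hcg.add hch

/-- **The weak limit of weak-`L³`-bounded data lies in `E²`** (the datum class of Seregin's decay
theorem): in `exists_strictMono_weakLimit_weakL3` the limit `g + h` is uniformly locally square
integrable with unit-ball energies vanishing at infinity (`L² + L⁴ ⊂ E²`). [folklore] -/
theorem exists_strictMono_weakLimit_weakL3_memE2 (M : ℝ≥0) (a : ℕ → ℝ³ → ℝ³)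
    (ha : ∀ k, FunctionSpaces.MemWeakLp (a k) 3 volume)
    (hM : ∀ k, FunctionSpaces.eWeakLpPow (a k) 3 volume ≤ M) :
    ∃ (σ : ℕ → ℕ) (g h : ℝ³ → ℝ³), StrictMono σ ∧
      MemLp g 2 volume ∧ eLpNorm g 2 volume ≤ (3 * (M : ℝ≥0∞)) ^ (1 / 2 : ℝ) ∧
      MemLp h 4 volume ∧ eLpNorm h 4 volume ≤ (4 * (M : ℝ≥0∞)) ^ (1 / 4 : ℝ) ∧
      eLpNorm h ∞ volume ≤ 1 ∧ MemE2 (g + h) ∧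
      ∀ φ : ℝ³ → ℝ³, Continuous φ → HasCompactSupport φ →
        Tendsto (fun k => ∫ x, ⟪a (σ k) x, φ x⟫) atTop (𝓝 (∫ x, ⟪g x + h x, φ x⟫)) := by
  obtain ⟨σ, g, h, hσ, hg, hgB, hh, hhB, hh1, hconv⟩ := exists_strictMono_weakLimit_weakL3 M a ha hM
  exact ⟨σ, g, h, hσ, hg, hgB, hh, hhB, hh1,
    memE2_add_of_memLp hg le_rfl ENNReal.ofNat_ne_top hh (by norm_num) ENNReal.ofNat_ne_top, hconv⟩

end Literature.Analysis.FluidPDE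

end
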